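import Summits.NavierStokesRegularity.NavierStokesRegularity.Theses.CoreLogGas

/-!
# Crux `CoreLogGas.BlowupIsLocallyDriven` (stmt-NavierStokesRegularity-11291): the crux AS FILED follows from
# `NoBlowup` (stmt-NavierStokesRegularity-0054)

`--supports stmt-NavierStokesRegularity-11291` (lead `prover-line-stmt-NavierStokesRegularity-11291-c5-0`, 2026-08-17).

The upper half of the sandwich recorded by the refuters (EVIDENCE_11075.md, Evidence_B.lean, W.lean — evidence files, never
landed) and used by leads c3–c5: B quantifies over MAXIMAL smooth solutions (`IsMaximalSmoothSolution = classical on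
[0,T) ∧ no smooth extension past T`), so the continuation statement `NoBlowup` (item stmt-NavierStokesRegularity-0054,
text verbatim as the hypothesis below; also the hypothesis of this route's `NoBlowupToClay`) makes B vacuously true.
Together with `Negative.BlowupIsLocallyDriven_false_of_RigidFarStrainBlowup` (p154961: every rigidly far-strained collapse
violates B) this is the formal content of the leads' finding that B as filed is pinned between two open problems, and the
certificate behind the `blocked-on: stmt-NavierStokesRegularity-0054` relation for the filed text.
-/

noncomputable section

-- justification: the namespace is fixed by the crux protocol (sibling files of this crux use `…Theorems.BlowupIsLocallyDriven.*`).
set_option linter.dupNamespace false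

namespace Summit.NavierStokesRegularity.NavierStokesRegularity.Theorems.BlowupIsLocallyDriven.Sandwich

/-- **`NoBlowup` ⇒ B (registered stub `blowupIsLocallyDriven_of_noBlowup`).** If every classical Leray–Hopf solution
from rapidly decaying data extends smoothly past every `T` (the text of item stmt-NavierStokesRegularity-0054 verbatim),
then `BlowupIsLocallyDriven` holds — vacuously, since no maximal smooth solution exists. [folklore] -/
theorem blowupIsLocallyDriven_of_noBlowup : (∀ (ν T : ℝ), 0 < ν → 0 < T → ∀ (u : ℝ → EuclideanSpace ℝ (Fin 3) → EuclideanSpace ℝ (Fin 3)) (p : ℝ → EuclideanSpace ℝ (Fin 3) → ℝ), Literature.Analysis.FluidPDE.IsClassicalNSSolutionOn (Set.Ico 0 T) ν 0 u p → Literature.Analysis.FluidPDE.IsLerayHopfOn T ν 0 (u 0) u → Literature.Analysis.FluidPDE.HasRapidSpatialDecay (u 0) → Literature.Analysis.FluidPDE.HasSmoothExtensionPast ν 0 u T) → Summit.NavierStokesRegularity.NavierStokesRegularity.Theses.CoreLogGas.BlowupIsLocallyDriven := by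
  intro hN ν T hν hT u p hmax hlh hdec
  exact absurd (hN ν T hν hT u p hmax.1 hlh hdec) hmax.2

/-- **B as filed is sandwiched**: `NoBlowup → B` (above) and `B → NoBlowupToClay`'s hypothesis is NOT claimed; the lower
half is `Negative.BlowupIsLocallyDriven_false_of_RigidFarStrainBlowup` (p154961). This corollary only records that under
`NoBlowup` the whole route thesis `LocallyDrivenIsTypeI ∧ BlowupIsLocallyDriven` holds vacuously (both quantify over maximal
solutions), i.e. neither crux can be refuted short of exhibiting a Navier–Stokes blow-up. [folklore] -/
theorem cruxes_of_noBlowup (hN : ∀ (ν T : ℝ), 0 < ν → 0 < T → ∀ (u : ℝ → EuclideanSpace ℝ (Fin 3) → EuclideanSpace ℝ (Fin 3)) (p : ℝ → EuclideanSpace ℝ (Fin 3) → ℝ), Literature.Analysis.FluidPDE.IsClassicalNSSolutionOn (Set.Ico 0 T) ν 0 u p → Literature.Analysis.FluidPDE.IsLerayHopfOn T ν 0 (u 0) u → Literature.Analysis.FluidPDE.HasRapidSpatialDecay (u 0) → Literature.Analysis.FluidPDE.HasSmoothExtensionPast ν 0 u T) :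
    Summit.NavierStokesRegularity.NavierStokesRegularity.Theses.CoreLogGas.LocallyDrivenIsTypeI ∧
      Summit.NavierStokesRegularity.NavierStokesRegularity.Theses.CoreLogGas.BlowupIsLocallyDriven :=
  ⟨fun ν T hν hT u p hmax hlh hdec _ => absurd (hN ν T hν hT u p hmax.1 hlh hdec) hmax.2,
    blowupIsLocallyDriven_of_noBlowup hN⟩

end Summit.NavierStokesRegularity.NavierStokesRegularity.Theorems.BlowupIsLocallyDriven.Sandwich
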